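import Mathlib
import Summits.ValiantsHypothesis.ValiantsHypothesis.Theorems.ChowBorderDepth3ChowBorderBoundFanInTwoRung

/-!
# Stub `stub_fanInTwoChasmArith` of crux `ChowBorderDepth3.ChowBorderBound`
# (stmt-ValiantsHypothesis-5936), line `registered`

Pure `ℕ` arithmetic closing the fan-in-two rung of the crux: a two-summand border Chow expression
of the padded permanent with `D` factors forces `C(⌊n/4⌋, ⌊n/8⌋) ≤ 4 D` (`n ≥ 8`), and this file
shows that this is impossible throughout the chasm range `D ≤ (n+2)^(c⌊√n⌋+c)`: for every `c`,
eventually in `n`,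

  `4 · (n+2)^(c⌊√n⌋+c) < C(⌊n/4⌋, ⌊n/8⌋)`.

## Proof

With `m = ⌊n/8⌋` and `c' = 8c + 1`, for `m ≥ (16(c'+3))⁴`:

* `2^⌊n/4⌋ ≤ (⌊n/4⌋+1) · C(⌊n/4⌋, ⌊n/8⌋)` (`FanInTwoRung.two_pow_le_succ_mul_choose_middle`, as
  `⌊⌊n/4⌋/2⌋ = ⌊n/8⌋`);
* `4^m ≤ 2^⌊n/4⌋` (`2m ≤ ⌊n/4⌋`);
* `(m+2)^(c'⌊√m⌋+c'+3) ≤ 4^m` (`FanInTwoRung.chasm_pow_le_four_pow`);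
* `8 (⌊n/4⌋+1) (n+2)^(c⌊√n⌋+c) ≤ (m+2)^(c'⌊√m⌋+c'+3)`, because `n + 2 ≤ (m+2)²`,
  `⌊√n⌋ ≤ 3⌊√m⌋ + 3` and `8(⌊n/4⌋+1) ≤ 16(m+1) ≤ (m+2)⁴` (`eight_mul_chasm_le`).

Chaining and cancelling `⌊n/4⌋ + 1` gives `8 (n+2)^(c⌊√n⌋+c) ≤ C(⌊n/4⌋, ⌊n/8⌋)`, whence the
strict bound with the factor `4`.
-/

-- the tree's mandated single-conjunct layout (Sub = Summit) duplicates the namespace component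
set_option linter.dupNamespace false

namespace Summit.ValiantsHypothesis.ValiantsHypothesis.Theorems.ChowBorderBound.FanInTwoChasmArith

open Summit.ValiantsHypothesis.ValiantsHypothesis.Theorems.ChowBorderBound.FanInTwoRung

/-- `⌊√n⌋ ≤ 3⌊√m⌋ + 3` whenever `n ≤ 8m + 7` (in particular for `m = ⌊n/8⌋`). -/
theorem sqrt_le_of_le_eight_mul (m n : ℕ) (h : n ≤ 8 * m + 7) :
    Nat.sqrt n ≤ 3 * Nat.sqrt m + 3 := by
  set s := Nat.sqrt m with hs
  have hm : m < (s + 1) ^ 2 := Nat.lt_succ_sqrt' m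
  have hn : n < (3 * s + 3 + 1) ^ 2 := by nlinarith
  exact Nat.le_of_lt_succ (Nat.sqrt_lt'.2 hn)

/-- The comparison step: with `m = ⌊n/8⌋ ≥ 5` and `c' = 8c + 1`,
`8 (⌊n/4⌋ + 1) (n+2)^(c⌊√n⌋+c) ≤ (m+2)^(c'⌊√m⌋ + c' + 3)`. -/
theorem eight_mul_chasm_le (c n : ℕ) (hm : 5 ≤ n / 8) :
    8 * (n / 4 + 1) * (n + 2) ^ (c * Nat.sqrt n + c) ≤
      (n / 8 + 2) ^ ((8 * c + 1) * Nat.sqrt (n / 8) + (8 * c + 1) + 3) := by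
  set m := n / 8 with hm_def
  set s := Nat.sqrt m with hs
  have hn_le : n ≤ 8 * m + 7 := by omega
  -- (a) the base
  have ha : n + 2 ≤ (m + 2) ^ 2 := by nlinarith
  -- (b) the square roots
  have hb : Nat.sqrt n ≤ 3 * s + 3 := sqrt_le_of_le_eight_mul m n hn_le
  -- (c) the chasm power
  have hc : (n + 2) ^ (c * Nat.sqrt n + c) ≤ (m + 2) ^ (6 * c * s + 8 * c) :=
    calc (n + 2) ^ (c * Nat.sqrt n + c)
        ≤ ((m + 2) ^ 2) ^ (c * Nat.sqrt n + c) := Nat.pow_le_pow_left ha _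
      _ ≤ ((m + 2) ^ 2) ^ (c * (3 * s + 3) + c) := by
          apply Nat.pow_le_pow_right (by positivity)
          have := Nat.mul_le_mul_left c hb
          omega
      _ = (m + 2) ^ (6 * c * s + 8 * c) := by
          rw [← pow_mul]
          congr 1
          ring
  -- (d) the polynomial prefactor
  have hd : 8 * (n / 4 + 1) ≤ (m + 2) ^ 4 :=
    calc 8 * (n / 4 + 1) ≤ 16 * (m + 1) := by omega
      _ ≤ (m + 2) ^ 2 * (m + 2) ^ 2 := Nat.mul_le_mul (by nlinarith) (by nlinarith)
      _ = (m + 2) ^ 4 := by ring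
  -- (e) assemble
  calc 8 * (n / 4 + 1) * (n + 2) ^ (c * Nat.sqrt n + c)
      ≤ (m + 2) ^ 4 * (m + 2) ^ (6 * c * s + 8 * c) := Nat.mul_le_mul hd hc
    _ = (m + 2) ^ (6 * c * s + 8 * c + 4) := by ring
    _ ≤ (m + 2) ^ ((8 * c + 1) * s + (8 * c + 1) + 3) := by
        apply Nat.pow_le_pow_right (by omega)
        nlinarith

/-- **Stub `stub_fanInTwoChasmArith`** (registered stub of crux stmt-ValiantsHypothesis-5936, line
`registered`): for every `c`, eventually in `n`, `n ≥ 8` and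
`4 · (n+2)^(c⌊√n⌋+c) < C(⌊n/4⌋, ⌊n/8⌋)` — the chasm range lies strictly below the binomial
coefficient forced by a two-summand border Chow expression of the padded permanent. -/
theorem stub_fanInTwoChasmArith :
    ∀ c : ℕ, ∃ n₀ : ℕ, ∀ n : ℕ, n₀ ≤ n → 8 ≤ n ∧ 4 * (n + 2) ^ (c * Nat.sqrt n + c) < (n / 4).choose (n / 8) := by
  intro c
  set T := (16 * (8 * c + 1 + 3)) ^ 4 with hT_def
  refine ⟨8 * T + 40, fun n hn => ⟨by omega, ?_⟩⟩
  set m := n / 8 with hm_def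
  have hT : T ≤ m := by omega
  have hm5 : 5 ≤ m := by omega
  have h84 : n / 4 / 2 = m := by omega
  have h2m : 2 * m ≤ n / 4 := by omega
  -- (1) the middle binomial coefficient of `⌊n/4⌋`
  have h1 : 2 ^ (n / 4) ≤ (n / 4 + 1) * (n / 4).choose m := by
    have := two_pow_le_succ_mul_choose_middle (n / 4)
    rwa [h84] at this
  -- (2) `4^m ≤ 2^⌊n/4⌋`
  have h2 : 4 ^ m ≤ 2 ^ (n / 4) :=
    calc 4 ^ m = 2 ^ (2 * m) := by rw [pow_mul]; norm_num
      _ ≤ 2 ^ (n / 4) := Nat.pow_le_pow_right (by norm_num) h2m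
  -- (3) the chasm bound for `c' = 8c + 1` at `m`
  have h3 : (m + 2) ^ ((8 * c + 1) * Nat.sqrt m + (8 * c + 1) + 3) ≤ 4 ^ m :=
    chasm_pow_le_four_pow (8 * c + 1) m hT
  -- (4) the comparison
  have h4 := eight_mul_chasm_le c n hm5
  -- (5) chain and cancel `⌊n/4⌋ + 1`
  have hchain : (n / 4 + 1) * (8 * (n + 2) ^ (c * Nat.sqrt n + c)) ≤
      (n / 4 + 1) * (n / 4).choose m :=
    calc (n / 4 + 1) * (8 * (n + 2) ^ (c * Nat.sqrt n + c))
        = 8 * (n / 4 + 1) * (n + 2) ^ (c * Nat.sqrt n + c) := by ring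
      _ ≤ (m + 2) ^ ((8 * c + 1) * Nat.sqrt m + (8 * c + 1) + 3) := h4
      _ ≤ 4 ^ m := h3
      _ ≤ 2 ^ (n / 4) := h2
      _ ≤ (n / 4 + 1) * (n / 4).choose m := h1
  have h8 : 8 * (n + 2) ^ (c * Nat.sqrt n + c) ≤ (n / 4).choose m :=
    Nat.le_of_mul_le_mul_left hchain (by omega)
  have hX : 1 ≤ (n + 2) ^ (c * Nat.sqrt n + c) := Nat.one_le_pow _ _ (by omega)
  omega

end Summit.ValiantsHypothesis.ValiantsHypothesis.Theorems.ChowBorderBound.FanInTwoChasmArith
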